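import Summits.Ventures.Crystal3D.Theorems.StickyWulffConstantCoaxialWallLawReachConeWith
import HarnessLib

/-!
# Restatement programme, reach cone: the WIDE-SLOT links AT explicit constants (`R₀ = 10`)

HONEST FRAMING. Venture `Summits/Ventures/Crystal3D` (cell `crystal3d-full`); helper for the crux `TextureLiminf` (stmt-Ventures-19483,
line `TexShadow`) and lane F's debt F-U (cf-p1 DECISION (lxvii), 2026-08-29).  Rung credit only (census-free, standard axioms); F-C1
not moved; E1 (`ExactOnly`) and `StarPairFar` stay BY NAME.  `coaxialTwoSlabAdhesion_of_level_third_wide` (…ChainTorsionWide) and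
`coaxialTwoSlabAdhesion_of_wide_slot` (…VicinalCore) in the explicit-constant currency (proofs = the originals' with `At` ↦ `With`):
`coaxialOnWith_of_level_third_wide`, `coaxialOnWith_of_wide_slot` — ONE `C = (240√2π + 4440·42)/2 + 16000 + K` for all data.
-/

noncomputable section

namespace Summit.Ventures.Crystal3D.Theorems

open Summit.Ventures.Crystal3D Finset
open Literature.MathematicalPhysics.StatisticalMechanics (fccStacking barlowStacking IsHaggSeq contactDeficiency
  isHaggSeq_const)
open scoped InnerProductSpace

open scoped Classical in
/-- **Level-⅓ wide pairs with a presenting frame of small charge, explicit constants** (`coaxialTwoSlabAdhesion_of_level_third_wide`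
in the With-currency); one absolute `K`. -/
theorem coaxialOnWith_of_level_third_wide : ∃ K : ℝ, ∀
    {s₀ : EuclideanSpace ℝ (Fin 3)} (_hs₀ : s₀ ∈ fccSlots)
    (_hcert : ExactOnly 0 (fccSlots.filter fun w => 0 < ⟪w, s₀⟫_ℝ)) (_hSP : StarPairFar)
    (A₁ : EuclideanSpace ℝ (Fin 3) ≃ₗᵢ[ℝ] EuclideanSpace ℝ (Fin 3)) (t₁ : EuclideanSpace ℝ (Fin 3))
    (A₂ : EuclideanSpace ℝ (Fin 3) ≃ₗᵢ[ℝ] EuclideanSpace ℝ (Fin 3)) (t₂ : EuclideanSpace ℝ (Fin 3))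
    (L : EuclideanSpace ℝ (Fin 3) ≃ₗᵢ[ℝ] EuclideanSpace ℝ (Fin 3)) (s₁ s₂ : EuclideanSpace ℝ (Fin 3)) {σ σ' : ℤ → ℤ}
    (_hσ : IsHaggSeq σ) (_hσ' : IsHaggSeq σ')
    (_hsub₁ : (fun p => A₁ p + t₁) '' fccStacking 1 (Real.sqrt (2 / 3)) ⊆
      (fun p => L p + s₁) '' barlowStacking 1 (Real.sqrt (2 / 3)) σ)
    (_hsub₂ : (fun p => A₂ p + t₂) '' fccStacking 1 (Real.sqrt (2 / 3)) ⊆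
      (fun p => L p + s₂) '' barlowStacking 1 (Real.sqrt (2 / 3)) σ')
    {u₁ n₁ : EuclideanSpace ℝ (Fin 3)} (_hu₁ : u₁ ∈ fccSlots)
    (_hup : (9 / 20 : ℝ) ≤ ⟪A₁ u₁, EuclideanSpace.single (2 : Fin 3) (1 : ℝ)⟫_ℝ) (_hn₁ : ‖n₁‖ = 1)
    (_hmenu₁ : ∀ w ∈ fccSlots, ⟪A₁ w, n₁⟫_ℝ = 0 ∨ ⟪A₁ w, n₁⟫_ℝ = Real.sqrt (2 / 3) ∨ ⟪A₁ w, n₁⟫_ℝ = -Real.sqrt (2 / 3))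
    (_hun : ⟪A₁ u₁, n₁⟫_ℝ = Real.sqrt (2 / 3))
    (_hΛ : A₂ '' fccStacking 1 (Real.sqrt (2 / 3)) = A₁ '' fccStacking 1 (Real.sqrt (2 / 3)) ∨
      A₂ '' fccStacking 1 (Real.sqrt (2 / 3)) = twinFrame A₁ n₁ '' fccStacking 1 (Real.sqrt (2 / 3)))
    (_h3 : A₁.symm ((3 : ℝ) • (t₂ - t₁)) ∈ fccStacking 1 (Real.sqrt (2 / 3)))
    (_hnot : ∀ a b : ℤ, A₁.symm (t₂ - t₁ - (a : ℝ) • (Real.sqrt (2 / 3) • n₁) -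
      (b : ℝ) • (Real.sqrt (2 / 3) • ((2 * Real.sqrt (2 / 3)) • A₁ u₁ - n₁))) ∉ fccStacking 1 (Real.sqrt (2 / 3)))
    (_hcmp : (1 / 2 : ℝ) * Real.sqrt (1 - ⟪L (EuclideanSpace.single (2 : Fin 3) (1 : ℝ)),
      (EuclideanSpace.single (2 : Fin 3) (1 : ℝ))⟫_ℝ ^ 2) ≤ Real.sqrt 2 * ⟪A₁ u₁, EuclideanSpace.single (2 : Fin 3) (1 : ℝ)⟫_ℝ / 2),
    ∃ (L : EuclideanSpace ℝ (Fin 3) ≃ₗᵢ[ℝ] EuclideanSpace ℝ (Fin 3))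
        (s₁ s₂ : EuclideanSpace ℝ (Fin 3)) (σ σ' : ℤ → ℤ), IsHaggSeq σ ∧ IsHaggSeq σ' ∧
        (fun p => A₁ p + t₁) '' fccStacking 1 (Real.sqrt (2 / 3)) ⊆
          (fun p => L p + s₁) '' barlowStacking 1 (Real.sqrt (2 / 3)) σ ∧
        (fun p => A₂ p + t₂) '' fccStacking 1 (Real.sqrt (2 / 3)) ⊆
          (fun p => L p + s₂) '' barlowStacking 1 (Real.sqrt (2 / 3)) σ' ∧
        TwoSlabLedgerWith ((240 * Real.sqrt 2 * Real.pi + 4440 * (4 * 10 + 2)) / 2 + 16000 + K) 10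
          ((1 / 2 : ℝ) * Real.sqrt (1 - ⟪L (EuclideanSpace.single (2 : Fin 3) (1 : ℝ)),
            (EuclideanSpace.single (2 : Fin 3) (1 : ℝ))⟫_ℝ ^ 2)) A₁ t₁ A₂ t₂ := by
  obtain ⟨K, hK⟩ := twoSlabLedgerWith_oneSided_of_level_third_wide
  refine ⟨K, ?_⟩
  intro s₀ hs₀ hcert hSP A₁ t₁ A₂ t₂ L s₁ s₂ σ σ' hσ hσ' hsub₁ hsub₂ u₁ n₁ hu₁ hup hn₁ hmenu₁ hun hΛ h3 hnot hcmp
  exact ⟨L, s₁, s₂, σ, σ', hσ, hσ', hsub₁, hsub₂, twoSlabLedgerWith_anti hcmp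
    (hK hs₀ hcert hSP A₁ t₁ A₂ t₂ hu₁ hup hn₁ hmenu₁ hun hΛ h3 hnot)⟩

open scoped Classical in
/-- **Wide slots with an admissible axis, explicit constants** (`coaxialTwoSlabAdhesion_of_wide_slot` in the With-currency: a
level-⅓ pair, a slot `u₁` of grain 1 with `⟪A₁u₁, e₃⟫ ≥ 9/20` in the menu plane `n₁`, the offset outside the two fault cosets, and an
admissible axis `m` dominated by the slot — frame `L e₃ = m`); one absolute `K`. -/
theorem coaxialOnWith_of_wide_slot : ∃ K : ℝ, ∀
    {s₀ : EuclideanSpace ℝ (Fin 3)} (_hs₀ : s₀ ∈ fccSlots)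
    (_hcert : ExactOnly 0 (fccSlots.filter fun w => 0 < ⟪w, s₀⟫_ℝ)) (_hSP : StarPairFar)
    (A₁ : EuclideanSpace ℝ (Fin 3) ≃ₗᵢ[ℝ] EuclideanSpace ℝ (Fin 3)) (t₁ : EuclideanSpace ℝ (Fin 3))
    (A₂ : EuclideanSpace ℝ (Fin 3) ≃ₗᵢ[ℝ] EuclideanSpace ℝ (Fin 3)) (t₂ : EuclideanSpace ℝ (Fin 3))
    {m : EuclideanSpace ℝ (Fin 3)} (_hm : ‖m‖ = 1)
    (_hmenum : ∀ w ∈ fccSlots, ⟪A₁ w, m⟫_ℝ = 0 ∨ ⟪A₁ w, m⟫_ℝ = Real.sqrt (2 / 3) ∨ ⟪A₁ w, m⟫_ℝ = -Real.sqrt (2 / 3))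
    (_hadm : A₂ '' fccStacking 1 (Real.sqrt (2 / 3)) = A₁ '' fccStacking 1 (Real.sqrt (2 / 3)) ∨
      A₂ '' fccStacking 1 (Real.sqrt (2 / 3)) = twinFrame A₁ m '' fccStacking 1 (Real.sqrt (2 / 3)))
    {u₁ n₁ : EuclideanSpace ℝ (Fin 3)} (_hu₁ : u₁ ∈ fccSlots)
    (_hup : (9 / 20 : ℝ) ≤ ⟪A₁ u₁, EuclideanSpace.single (2 : Fin 3) (1 : ℝ)⟫_ℝ)
    (_hdom : Real.sqrt (1 - ⟪m, EuclideanSpace.single (2 : Fin 3) (1 : ℝ)⟫_ℝ ^ 2) ≤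
      Real.sqrt 2 * ⟪A₁ u₁, EuclideanSpace.single (2 : Fin 3) (1 : ℝ)⟫_ℝ)
    (_hn₁ : ‖n₁‖ = 1)
    (_hmenu₁ : ∀ w ∈ fccSlots, ⟪A₁ w, n₁⟫_ℝ = 0 ∨ ⟪A₁ w, n₁⟫_ℝ = Real.sqrt (2 / 3) ∨ ⟪A₁ w, n₁⟫_ℝ = -Real.sqrt (2 / 3))
    (_hun : ⟪A₁ u₁, n₁⟫_ℝ = Real.sqrt (2 / 3))
    (_hΛ : A₂ '' fccStacking 1 (Real.sqrt (2 / 3)) = A₁ '' fccStacking 1 (Real.sqrt (2 / 3)) ∨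
      A₂ '' fccStacking 1 (Real.sqrt (2 / 3)) = twinFrame A₁ n₁ '' fccStacking 1 (Real.sqrt (2 / 3)))
    (_h3 : A₁.symm ((3 : ℝ) • (t₂ - t₁)) ∈ fccStacking 1 (Real.sqrt (2 / 3)))
    (_hnot : ∀ a b : ℤ, A₁.symm (t₂ - t₁ - (a : ℝ) • (Real.sqrt (2 / 3) • n₁) -
      (b : ℝ) • (Real.sqrt (2 / 3) • ((2 * Real.sqrt (2 / 3)) • A₁ u₁ - n₁))) ∉ fccStacking 1 (Real.sqrt (2 / 3))),
    ∃ (L : EuclideanSpace ℝ (Fin 3) ≃ₗᵢ[ℝ] EuclideanSpace ℝ (Fin 3))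
        (s₁ s₂ : EuclideanSpace ℝ (Fin 3)) (σ σ' : ℤ → ℤ), IsHaggSeq σ ∧ IsHaggSeq σ' ∧
        (fun p => A₁ p + t₁) '' fccStacking 1 (Real.sqrt (2 / 3)) ⊆
          (fun p => L p + s₁) '' barlowStacking 1 (Real.sqrt (2 / 3)) σ ∧
        (fun p => A₂ p + t₂) '' fccStacking 1 (Real.sqrt (2 / 3)) ⊆
          (fun p => L p + s₂) '' barlowStacking 1 (Real.sqrt (2 / 3)) σ' ∧
        TwoSlabLedgerWith ((240 * Real.sqrt 2 * Real.pi + 4440 * (4 * 10 + 2)) / 2 + 16000 + K) 10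
          ((1 / 2 : ℝ) * Real.sqrt (1 - ⟪L (EuclideanSpace.single (2 : Fin 3) (1 : ℝ)),
            (EuclideanSpace.single (2 : Fin 3) (1 : ℝ))⟫_ℝ ^ 2)) A₁ t₁ A₂ t₂ := by
  obtain ⟨K, hK⟩ := coaxialOnWith_of_level_third_wide
  refine ⟨K, ?_⟩
  intro s₀ hs₀ hcert hSP A₁ t₁ A₂ t₂ m hm hmenum hadm u₁ n₁ hu₁ hup hdom hn₁ hmenu₁ hun hΛ h3 hnot
  obtain ⟨L, hLΛ, hLe⟩ := exists_frame_of_menu A₁ hm hmenum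
  have hsub₁ := movedFcc_subset_frame hLΛ t₁
  have hcmp : (1 / 2 : ℝ) * Real.sqrt (1 - ⟪L (EuclideanSpace.single (2 : Fin 3) (1 : ℝ)),
      (EuclideanSpace.single (2 : Fin 3) (1 : ℝ))⟫_ℝ ^ 2) ≤
      Real.sqrt 2 * ⟪A₁ u₁, EuclideanSpace.single (2 : Fin 3) (1 : ℝ)⟫_ℝ / 2 := by
    rw [hLe]; linarith
  rcases hadm with hadm | hadm
  · exact hK hs₀ hcert hSP A₁ t₁ A₂ t₂ L t₁ t₂ isHaggSeq_const isHaggSeq_const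
      hsub₁ (movedFcc_subset_frame (hLΛ.trans hadm.symm) t₂) hu₁ hup hn₁ hmenu₁ hun hΛ h3 hnot hcmp
  · exact hK hs₀ hcert hSP A₁ t₁ A₂ t₂ L t₁ t₂ isHaggSeq_const isHaggSeq_negConst
      hsub₁ (movedFcc_subset_frame_negConst (twin_image_eq_frame_negConst hm hLΛ hLe hadm) t₂) hu₁ hup hn₁ hmenu₁ hun hΛ
      h3 hnot hcmp

end Summit.Ventures.Crystal3D.Theorems

end
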